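import Summits.ValiantsHypothesis.ValiantsHypothesis.Theorems.LacunarySymmetroidMatrixDescartesCensusDefs
import Summits.ValiantsHypothesis.ValiantsHypothesis.Theorems.LacunarySymmetroidMatrixDescartesCensusTwistedRolleMult
import Summits.ValiantsHypothesis.ValiantsHypothesis.Theorems.LacunarySymmetroidMatrixDescartesStubDescartesCeiling
import Summits.ValiantsHypothesis.ValiantsHypothesis.Theorems.SymmetroidPencilBasics
import Literature.Algebra.Polynomial.DescartesSignVariations
import Literature.Computability.AlgebraicComplexity.RealTauKnownCases

/-!
# `MatrixDescartes` census — ROOT STRUCTURE of a hypothetical twenty, for ALL supports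

HONEST FRAMING.  Object-search cell `pub-symmetroid`, door-A seat `val-sym-door-p1` (items stmt-ValiantsHypothesis-19979 `DoorA26`,
stmt-ValiantsHypothesis-19980 `DoorA34`; OPEN, never asserted).  A counterexample to `DoorA26` is ONE real symmetric `2 × 2` six-term pencil
`F = ∑ X^(d l) • S l` with `20` distinct positive det-roots (`Census.not_doorA26_iff`).  This file records, for EVERY support `d`, what such an
object must look like AT ITS ROOTS — the base facts of any root-side (envelope / inertia) argument:

* `rootMultiplicity_eq_one_of_twenty` — all `20` positive det-roots are SIMPLE (Descartes with multiplicity allows `20` in total);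
* `pencil_eval_ne_zero_of_twenty` — at a positive det-root `r` the matrix `F(r)` is NOT the zero matrix (else `(X − r)² ∣ det F`);
* `trace_pencil_eval_ne_zero_of_twenty` — symmetric letters: `tr F(r) ≠ 0` at every positive det-root (a symmetric `2 × 2` matrix with
  `det = tr = 0` is zero), so `F(r)` is SEMIDEFINITE OF RANK ONE with a well-defined TYPE `sign tr F(r)`;
* `trace_mul_quadForm_nonneg_of_det_eq_zero` — the type controls every direction: `tr F(r) · uᵀ F(r) u ≥ 0` for all `u`.

All supports, no certificate; nothing here bounds `ζ_sym(2,6)`, decides `DoorA26`/`DoorA34`, or bears on `MatrixDescartes`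
(stmt-ValiantsHypothesis-18050) / `VP ≠ VNP`.

[folklore] Descartes' rule with multiplicity; `(X − r) ∣ a, b, c ⇒ (X − r)² ∣ ac − b²`; elementary `2 × 2` algebra.
-/

-- `Summit.ValiantsHypothesis.ValiantsHypothesis.…` repeats a component by the D-0017 layout
-- (single-conjunct summit), which the `dupNamespace` linter flags; the name is mandated.
set_option linter.dupNamespace false

namespace Summit.ValiantsHypothesis.ValiantsHypothesis.Theorems.LacunarySymmetroidMatrixDescartes.Census

open Polynomial Finset
open scoped BigOperators Polynomial Matrix
open Summit.ValiantsHypothesis.ValiantsHypothesis.Theorems.MatrixDescartes.Negative (PosRootLawAt)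
open Summit.ValiantsHypothesis.ValiantsHypothesis.Theorems.SymmetroidDescartes (eval_det_pencil)

/-! ### Multiplicity budget: a twenty spends all of Descartes' allowance -/

/-- For ANY six-term `2 × 2` pencil (any support, symmetric or not): positive det-roots counted WITH multiplicity number at most `20`.
[folklore] -/
theorem countP_posRoots_det_le_twenty (d : Fin 6 → ℕ) (S : Fin 6 → Matrix (Fin 2) (Fin 2) ℝ) :
    (Matrix.det (∑ l, ((X : ℝ[X]) ^ d l) • (S l).map C)).roots.countP (fun x => 0 < x) ≤ 20 := by
  set p := Matrix.det (∑ l, ((X : ℝ[X]) ^ d l) • (S l).map C) with hp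
  by_cases h0 : p = 0
  · rw [h0, Polynomial.roots_zero]; simp
  have h1 : p.roots.countP (fun x => 0 < x) ≤ p.signVariations := p.roots_countP_pos_le_signVariations
  have h2 := Literature.Computability.AlgebraicComplexity.signVariations_lt_card_support h0
  have h3 : p.support.card ≤ Nat.choose (2 + 6 - 1) 2 := StubDescartesCeiling.card_support_det_pencil_le d S
  have h4 : Nat.choose (2 + 6 - 1) 2 = 21 := by decide
  rw [h4] at h3
  omega

/-- **All roots of a twenty are simple.**  If a six-term `2 × 2` pencil (any support; symmetry not needed) has at least `20` distinct
positive det-roots, then every positive det-root has multiplicity exactly `1`. [folklore] -/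
theorem rootMultiplicity_eq_one_of_twenty (d : Fin 6 → ℕ) (S : Fin 6 → Matrix (Fin 2) (Fin 2) ℝ)
    (h20 : 20 ≤ ((Matrix.det (∑ l, ((X : ℝ[X]) ^ d l) • (S l).map C)).roots.toFinset.filter (fun t => 0 < t)).card)
    {r : ℝ} (hr0 : 0 < r) (hr : (Matrix.det (∑ l, ((X : ℝ[X]) ^ d l) • (S l).map C)).IsRoot r) :
    (Matrix.det (∑ l, ((X : ℝ[X]) ^ d l) • (S l).map C)).rootMultiplicity r = 1 := by
  classical
  set p := Matrix.det (∑ l, ((X : ℝ[X]) ^ d l) • (S l).map C) with hp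
  have hp0 : p ≠ 0 := by
    intro h0; rw [h0, Polynomial.roots_zero] at h20; simp at h20
  set Z := p.roots.toFinset.filter (fun t => 0 < t) with hZ
  have hmem : r ∈ Z := by
    rw [hZ, Finset.mem_filter, Multiset.mem_toFinset]; exact ⟨(mem_roots hp0).mpr hr, hr0⟩
  have hle : ∀ x ∈ Z, 1 ≤ p.rootMultiplicity x := by
    intro x hx
    rw [hZ, Finset.mem_filter, Multiset.mem_toFinset] at hx
    exact (rootMultiplicity_pos hp0).mpr ((mem_roots hp0).mp hx.1)
  have hsum : ∑ x ∈ Z, p.rootMultiplicity x ≤ ∑ x ∈ Z, 1 := by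
    rw [← countP_posRoots_eq_sum_rootMultiplicity, ← Finset.card_eq_sum_ones]
    exact (countP_posRoots_det_le_twenty d S).trans h20
  have hsum' : ∑ x ∈ Z, (1 : ℕ) ≤ ∑ x ∈ Z, p.rootMultiplicity x := Finset.sum_le_sum hle
  have heq : ∑ x ∈ Z, (1 : ℕ) = ∑ x ∈ Z, p.rootMultiplicity x := le_antisymm hsum' hsum
  exact ((Finset.sum_eq_sum_iff_of_le hle).mp heq r hmem).symm

/-! ### The matrix at a root: non-zero, semidefinite of rank one, with a well-defined type -/

/-- Entries of the pencil evaluated at a point: `(∑ l, X^(d l) • (S l).map C) i j` evaluates at `r` to `(∑ l, r^(d l) • S l) i j`. [folklore] -/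
theorem eval_pencil_apply {K m : ℕ} (d : Fin K → ℕ) (S : Fin K → Matrix (Fin m) (Fin m) ℝ) (i j : Fin m) (r : ℝ) :
    ((∑ l, ((X : ℝ[X]) ^ d l) • (S l).map C) i j).eval r = (∑ l, r ^ d l • S l) i j := by
  rw [StubDescartesCeiling.pencil_apply, eval_finsetSum, Matrix.sum_apply]
  refine Finset.sum_congr rfl fun l _ => ?_
  rw [eval_mul, eval_pow, eval_X, eval_C, Matrix.smul_apply, smul_eq_mul]

/-- If every entry of a `2 × 2` polynomial matrix vanishes at `r`, then `(X − C r)²` divides its determinant. [folklore] -/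
theorem X_sub_C_sq_dvd_det_of_eval_apply_eq_zero (M : Matrix (Fin 2) (Fin 2) ℝ[X]) (r : ℝ)
    (h : ∀ i j, (M i j).IsRoot r) : (X - C r) ^ 2 ∣ M.det := by
  rw [Matrix.det_fin_two]
  have hd : ∀ i j, X - C r ∣ M i j := fun i j => dvd_iff_isRoot.mpr (h i j)
  rw [pow_two]
  exact dvd_sub (mul_dvd_mul (hd 0 0) (hd 1 1)) (mul_dvd_mul (hd 0 1) (hd 1 0))

/-- **At a root of a twenty the matrix is not zero** (any support; symmetry not needed): if `F = ∑ r^(d l) S l` vanished entirely at a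
positive det-root `r`, that root would be at least double. [folklore] -/
theorem pencil_eval_ne_zero_of_twenty (d : Fin 6 → ℕ) (S : Fin 6 → Matrix (Fin 2) (Fin 2) ℝ)
    (h20 : 20 ≤ ((Matrix.det (∑ l, ((X : ℝ[X]) ^ d l) • (S l).map C)).roots.toFinset.filter (fun t => 0 < t)).card)
    {r : ℝ} (hr0 : 0 < r) (hr : (Matrix.det (∑ l, ((X : ℝ[X]) ^ d l) • (S l).map C)).IsRoot r) :
    (∑ l, r ^ d l • S l) ≠ 0 := by
  classical
  intro hzero
  set P := (∑ l, ((X : ℝ[X]) ^ d l) • (S l).map C) with hP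
  have hp0 : P.det ≠ 0 := by
    intro h0; rw [h0, Polynomial.roots_zero] at h20; simp at h20
  have hent : ∀ i j, (P i j).IsRoot r := by
    intro i j
    rw [IsRoot.def, hP, eval_pencil_apply, hzero]; rfl
  have hdvd := X_sub_C_sq_dvd_det_of_eval_apply_eq_zero P r hent
  have h2 : 2 ≤ P.det.rootMultiplicity r := (le_rootMultiplicity_iff hp0).mpr hdvd
  have h1 := rootMultiplicity_eq_one_of_twenty d S h20 hr0 hr
  rw [← hP] at h1
  omega

/-- A real symmetric `2 × 2` matrix with `det = 0` and `tr = 0` is the zero matrix. [folklore] -/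
theorem eq_zero_of_isSymm_of_det_eq_zero_of_trace_eq_zero (M : Matrix (Fin 2) (Fin 2) ℝ) (hM : M.IsSymm)
    (hdet : M.det = 0) (htr : M 0 0 + M 1 1 = 0) : M = 0 := by
  have hs : M 1 0 = M 0 1 := by
    have h := congrFun (congrFun hM 0) 1
    simpa [Matrix.transpose_apply] using h
  rw [Matrix.det_fin_two, hs] at hdet
  have h11 : M 1 1 = -M 0 0 := by linarith
  rw [h11] at hdet
  have ha : M 0 0 = 0 := by nlinarith [sq_nonneg (M 0 0), sq_nonneg (M 0 1)]
  have hb : M 0 1 = 0 := by nlinarith [sq_nonneg (M 0 0), sq_nonneg (M 0 1)]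
  ext i j
  fin_cases i <;> fin_cases j
  · exact ha
  · exact hb
  · simp [hs, hb]
  · simp [h11, ha]

/-- **At a root of a twenty the trace does not vanish** (symmetric letters, any support): `F(r)` is singular, non-zero and symmetric, hence
semidefinite of rank one; its TYPE `sign tr F(r)` (`+` = PSD, `−` = NSD) is well defined. [folklore] -/
theorem trace_pencil_eval_ne_zero_of_twenty (d : Fin 6 → ℕ) (S : Fin 6 → Matrix (Fin 2) (Fin 2) ℝ) (hS : ∀ l, (S l).IsSymm)
    (h20 : 20 ≤ ((Matrix.det (∑ l, ((X : ℝ[X]) ^ d l) • (S l).map C)).roots.toFinset.filter (fun t => 0 < t)).card)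
    {r : ℝ} (hr0 : 0 < r) (hr : (Matrix.det (∑ l, ((X : ℝ[X]) ^ d l) • (S l).map C)).IsRoot r) :
    (∑ l, r ^ d l • S l) 0 0 + (∑ l, r ^ d l • S l) 1 1 ≠ 0 := by
  intro htr
  have hsym : (∑ l, r ^ d l • S l).IsSymm := by
    unfold Matrix.IsSymm
    rw [Matrix.transpose_sum]
    exact Finset.sum_congr rfl fun l _ => by rw [Matrix.transpose_smul, (hS l).eq]
  have hdet : (∑ l, r ^ d l • S l).det = 0 := by
    rw [← eval_det_pencil S d r]; exact hr
  exact pencil_eval_ne_zero_of_twenty d S h20 hr0 hr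
    (eq_zero_of_isSymm_of_det_eq_zero_of_trace_eq_zero _ hsym hdet htr)

/-- **The type controls every direction**: for a real symmetric `2 × 2` matrix with `det M = 0`, `tr M · uᵀ M u ≥ 0` for every `u`
(so a singular symmetric matrix with positive trace is PSD, with negative trace NSD). [folklore] -/
theorem trace_mul_quadForm_nonneg_of_det_eq_zero (M : Matrix (Fin 2) (Fin 2) ℝ) (hM : M.IsSymm) (hdet : M.det = 0)
    (u : Fin 2 → ℝ) : 0 ≤ (M 0 0 + M 1 1) * (u ⬝ᵥ (M *ᵥ u)) := by
  have hs : M 1 0 = M 0 1 := by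
    have h := congrFun (congrFun hM 0) 1
    simpa [Matrix.transpose_apply] using h
  rw [Matrix.det_fin_two, hs] at hdet
  have hq : u ⬝ᵥ (M *ᵥ u) = M 0 0 * u 0 ^ 2 + 2 * M 0 1 * u 0 * u 1 + M 1 1 * u 1 ^ 2 := by
    simp only [Matrix.mulVec, dotProduct, Fin.sum_univ_two, hs]
    ring
  rw [hq]
  have key : (M 0 0 + M 1 1) * (M 0 0 * u 0 ^ 2 + 2 * M 0 1 * u 0 * u 1 + M 1 1 * u 1 ^ 2)
      = (M 0 0 * u 0 + M 0 1 * u 1) ^ 2 + (M 0 1 * u 0 + M 1 1 * u 1) ^ 2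
        + (M 0 0 * M 1 1 - M 0 1 * M 0 1) * (u 0 ^ 2 + u 1 ^ 2) := by ring
  rw [key, hdet, zero_mul, add_zero]
  positivity

/-- **Root structure of a twenty, assembled** (symmetric letters, ANY support): at every positive det-root `r` of a six-term symmetric
`2 × 2` pencil with `20` distinct positive det-roots, the root is simple, `F(r)` is a non-zero singular matrix with `tr F(r) ≠ 0`, and
`tr F(r) · uᵀ F(r) u ≥ 0` for every direction `u` — `F(r)` is semidefinite of rank one, of type `sign tr F(r)`. [folklore] -/
theorem root_structure_of_twenty (d : Fin 6 → ℕ) (S : Fin 6 → Matrix (Fin 2) (Fin 2) ℝ) (hS : ∀ l, (S l).IsSymm)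
    (h20 : 20 ≤ ((Matrix.det (∑ l, ((X : ℝ[X]) ^ d l) • (S l).map C)).roots.toFinset.filter (fun t => 0 < t)).card)
    {r : ℝ} (hr0 : 0 < r) (hr : (Matrix.det (∑ l, ((X : ℝ[X]) ^ d l) • (S l).map C)).IsRoot r) :
    (Matrix.det (∑ l, ((X : ℝ[X]) ^ d l) • (S l).map C)).rootMultiplicity r = 1 ∧
      (∑ l, r ^ d l • S l) ≠ 0 ∧ (∑ l, r ^ d l • S l).det = 0 ∧
      (∑ l, r ^ d l • S l) 0 0 + (∑ l, r ^ d l • S l) 1 1 ≠ 0 ∧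
      ∀ u : Fin 2 → ℝ, 0 ≤ ((∑ l, r ^ d l • S l) 0 0 + (∑ l, r ^ d l • S l) 1 1) *
        (u ⬝ᵥ ((∑ l, r ^ d l • S l) *ᵥ u)) := by
  have hsym : (∑ l, r ^ d l • S l).IsSymm := by
    unfold Matrix.IsSymm
    rw [Matrix.transpose_sum]
    exact Finset.sum_congr rfl fun l _ => by rw [Matrix.transpose_smul, (hS l).eq]
  have hdet : (∑ l, r ^ d l • S l).det = 0 := by
    rw [← eval_det_pencil S d r]; exact hr
  exact ⟨rootMultiplicity_eq_one_of_twenty d S h20 hr0 hr, pencil_eval_ne_zero_of_twenty d S h20 hr0 hr, hdet,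
    trace_pencil_eval_ne_zero_of_twenty d S hS h20 hr0 hr,
    fun u => trace_mul_quadForm_nonneg_of_det_eq_zero _ hsym hdet u⟩

end Summit.ValiantsHypothesis.ValiantsHypothesis.Theorems.LacunarySymmetroidMatrixDescartes.Census
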